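import Summits.CriticalPhenomena.PercolationContinuityZ3.Theorems.PercTiltedBlockersCubeBlockingSeedRungOfTallTilt
import Summits.CriticalPhenomena.PercolationContinuityZ3.Theorems.PercTiltedBlockersCubeBlockingSeedLadder
import Summits.CriticalPhenomena.PercolationContinuityZ3.Theorems.PercTiltedBlockersCubeBlockingSeedTallSeedOfFlatAnnulusCrossing
import HarnessLib

/-!
# Crux `CubeBlockingSeed` (stmt-CriticalPhenomena-1141), line `registered` — the second entrance, importable

Helper file of the line lead (`--supports stmt-CriticalPhenomena-1141`, registered sub-goal
`stub_cruxOfFlatAnnulusCrossingOfTallTilt`). It composes the three landed pieces of the line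

* `CubeBlockingSeed.stub_tallSeedOfFlatAnnulusCrossing` (p149647): `PercDivergentSlabLadder.FlatAnnulusCrossing`
  (stmt-CriticalPhenomena-6699) ⟹ the tube seed `∃ k ≥ 1, SeedAt k`;
* `CubeBlockingSeed.stub_rungOfTallTilt` (p147062): the tall tilt comparison `TallTilt(k)` ⟹ the halving rung
  `SeedAt (2k) → SeedAt k`;
* `CubeBlockingSeed.stub_ladder` (p149603): tube seed + halving rungs ⟹ the crux,

into ONE importable statement: the sibling crux `FlatAnnulusCrossing` (6699, "RSW for flat washers at one aspect ratio,
uniformly in thickness") together with the tall tilt comparison (the registered open stub `stub_tallTilt` of this line,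
written out) imply `CubeBlockingSeed` — for the item's primary decl (`PercAnnulusCrossing`) and its verbatim twin
(`PercTiltedBlockers`). So the crux stmt-CriticalPhenomena-1141 is reduced to 6699 plus one tall-shape tilt statement.
No definitions; no unproved facts are used (both open statements enter as HYPOTHESES).
-/

noncomputable section

namespace Summit.CriticalPhenomena.PercolationContinuityZ3.Theorems.CubeBlockingSeed

open MeasureTheory Literature.Probability.Percolation Literature.Probability.LatticeModels
open Summit.CriticalPhenomena.PercolationContinuityZ3.Theses

/-- **`stub_cruxOfFlatAnnulusCrossingOfTallTilt`** (registered sub-goal of crux stmt-CriticalPhenomena-1141):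
`FlatAnnulusCrossing` (stmt-6699) and the tall tilt comparison (text of `stub_tallTilt`) imply the crux's body
(`∃ c > 0, ∀ n ≥ 1, c ≤ P_{p_c}([0,n]³ blocked face-to-face)`): tube seed from 6699 (`stub_tallSeedOfFlatAnnulusCrossing`),
halving rungs from the tilt comparison (`stub_rungOfTallTilt`), and the ladder (`stub_ladder`). [folklore] -/
theorem stub_cruxOfFlatAnnulusCrossingOfTallTilt :
    PercDivergentSlabLadder.FlatAnnulusCrossing →
      (∀ k : ℕ, 1 ≤ k →
        ∃ g : ℝ → ℝ, Monotone g ∧ (∀ s, 0 < s → 0 < g s) ∧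
          ∀ m L M : ℕ, 1 ≤ m → 2 * m ≤ L → L ≤ 5 * m → 2 * m ≤ M → M ≤ 5 * m → ∃ a : ℕ,
            g ((bondPercolation (zdGraph 3) (criticalProbI 3)).real
                {ω | ¬ ∃ x ∈ Finset.Icc (0 : Site 3) ![((4 * k * m : ℕ) : ℤ), L, M],
                  ∃ y ∈ Finset.Icc (0 : Site 3) ![((4 * k * m : ℕ) : ℤ), L, M],
                    x 0 = 0 ∧ y 0 = ((4 * k * m : ℕ) : ℤ) ∧
                      ω ∈ openConnIn ↑(Finset.Icc (0 : Site 3) ![((4 * k * m : ℕ) : ℤ), L, M]) x y}) ≤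
            (bondPercolation (zdGraph 3) (criticalProbI 3)).real
              {ω | ¬ ∃ x ∈ Finset.Icc (0 : Site 3) ![((4 * k * m : ℕ) : ℤ), L, M],
                ∃ y ∈ Finset.Icc (0 : Site 3) ![((4 * k * m : ℕ) : ℤ), L, M],
                  (x 0 = 0 ∨ (x 1 = L ∧ x 0 < a)) ∧
                    (y 0 = ((4 * k * m : ℕ) : ℤ) ∨ (y 1 = m ∧ (a : ℤ) ≤ y 0)) ∧
                    ω ∈ openConnIn ↑(Finset.Icc (0 : Site 3) ![((4 * k * m : ℕ) : ℤ), L, M]) x y}) →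
      ∃ c : ℝ, 0 < c ∧ ∀ n : ℕ, 1 ≤ n → c ≤ (bondPercolation (zdGraph 3) (criticalProbI 3)).real
        {ω | ¬ ∃ x ∈ Finset.Icc (0 : Site 3) ![(n : ℤ), n, n], ∃ y ∈ Finset.Icc (0 : Site 3) ![(n : ℤ), n, n],
          x 0 = 0 ∧ y 0 = n ∧ ω ∈ openConnIn ↑(Finset.Icc (0 : Site 3) ![(n : ℤ), n, n]) x y} :=
  fun h6699 hTilt => stub_ladder (stub_tallSeedOfFlatAnnulusCrossing h6699)
    (fun k hk h2k => stub_rungOfTallTilt k hk (hTilt k hk) h2k)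

/-- The same, concluding the item's primary decl `Theses.PercAnnulusCrossing.CubeBlockingSeed` by name. [folklore] -/
theorem cubeBlockingSeed_of_flatAnnulusCrossing_of_tallTilt
    (h6699 : PercDivergentSlabLadder.FlatAnnulusCrossing)
    (hTilt : ∀ k : ℕ, 1 ≤ k →
        ∃ g : ℝ → ℝ, Monotone g ∧ (∀ s, 0 < s → 0 < g s) ∧
          ∀ m L M : ℕ, 1 ≤ m → 2 * m ≤ L → L ≤ 5 * m → 2 * m ≤ M → M ≤ 5 * m → ∃ a : ℕ,
            g ((bondPercolation (zdGraph 3) (criticalProbI 3)).real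
                {ω | ¬ ∃ x ∈ Finset.Icc (0 : Site 3) ![((4 * k * m : ℕ) : ℤ), L, M],
                  ∃ y ∈ Finset.Icc (0 : Site 3) ![((4 * k * m : ℕ) : ℤ), L, M],
                    x 0 = 0 ∧ y 0 = ((4 * k * m : ℕ) : ℤ) ∧
                      ω ∈ openConnIn ↑(Finset.Icc (0 : Site 3) ![((4 * k * m : ℕ) : ℤ), L, M]) x y}) ≤
            (bondPercolation (zdGraph 3) (criticalProbI 3)).real
              {ω | ¬ ∃ x ∈ Finset.Icc (0 : Site 3) ![((4 * k * m : ℕ) : ℤ), L, M],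
                ∃ y ∈ Finset.Icc (0 : Site 3) ![((4 * k * m : ℕ) : ℤ), L, M],
                  (x 0 = 0 ∨ (x 1 = L ∧ x 0 < a)) ∧
                    (y 0 = ((4 * k * m : ℕ) : ℤ) ∨ (y 1 = m ∧ (a : ℤ) ≤ y 0)) ∧
                    ω ∈ openConnIn ↑(Finset.Icc (0 : Site 3) ![((4 * k * m : ℕ) : ℤ), L, M]) x y}) :
    PercAnnulusCrossing.CubeBlockingSeed :=
  stub_cruxOfFlatAnnulusCrossingOfTallTilt h6699 hTilt

/-- The same for the verbatim twin `Theses.PercTiltedBlockers.CubeBlockingSeed`. [folklore] -/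
theorem cubeBlockingSeed'_of_flatAnnulusCrossing_of_tallTilt
    (h6699 : PercDivergentSlabLadder.FlatAnnulusCrossing)
    (hTilt : ∀ k : ℕ, 1 ≤ k →
        ∃ g : ℝ → ℝ, Monotone g ∧ (∀ s, 0 < s → 0 < g s) ∧
          ∀ m L M : ℕ, 1 ≤ m → 2 * m ≤ L → L ≤ 5 * m → 2 * m ≤ M → M ≤ 5 * m → ∃ a : ℕ,
            g ((bondPercolation (zdGraph 3) (criticalProbI 3)).real
                {ω | ¬ ∃ x ∈ Finset.Icc (0 : Site 3) ![((4 * k * m : ℕ) : ℤ), L, M],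
                  ∃ y ∈ Finset.Icc (0 : Site 3) ![((4 * k * m : ℕ) : ℤ), L, M],
                    x 0 = 0 ∧ y 0 = ((4 * k * m : ℕ) : ℤ) ∧
                      ω ∈ openConnIn ↑(Finset.Icc (0 : Site 3) ![((4 * k * m : ℕ) : ℤ), L, M]) x y}) ≤
            (bondPercolation (zdGraph 3) (criticalProbI 3)).real
              {ω | ¬ ∃ x ∈ Finset.Icc (0 : Site 3) ![((4 * k * m : ℕ) : ℤ), L, M],
                ∃ y ∈ Finset.Icc (0 : Site 3) ![((4 * k * m : ℕ) : ℤ), L, M],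
                  (x 0 = 0 ∨ (x 1 = L ∧ x 0 < a)) ∧
                    (y 0 = ((4 * k * m : ℕ) : ℤ) ∨ (y 1 = m ∧ (a : ℤ) ≤ y 0)) ∧
                    ω ∈ openConnIn ↑(Finset.Icc (0 : Site 3) ![((4 * k * m : ℕ) : ℤ), L, M]) x y}) :
    PercTiltedBlockers.CubeBlockingSeed :=
  stub_cruxOfFlatAnnulusCrossingOfTallTilt h6699 hTilt

end Summit.CriticalPhenomena.PercolationContinuityZ3.Theorems.CubeBlockingSeed

end
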